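import Summits.Ventures.HodgeKum4.Theorems.KummerFixedLocusL1HilbJoinPolar
import HarnessLib

/-!
# Lane (V), line v2p5 — stub S-F (`stub_span`), JOIN half: the assembly `SF.JoinHalf` from (J1) `UnitReach` and (J2) `PolarReach`

Cell `hodge-kum4`, crux stmt-Ventures-20306 (`LefschetzGenerationHilb5`, W-form); seam `Theorems/KummerFixedLocusL1HilbSeam.lean`
(plan g19 d82d0eae62b73f6f), cut of record director-hodge g8 13:00:29Z / plan `SeamSF.v2.PLAN` e3a3fc3607265de7: JoinHalf ⇐ J1 + J2.
(J2) is the tree theorem `SF.polarReach` (`…L1HilbJoinPolar`).  (J1) — the all-unit monomials of every shape lie in a shape-graded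
`W ∋ 1_{S^[n]}` stable under cup with `G₁(1_S, n)` — is being landed by the seats hodge-kum4-p5 / hodge-kum4-plan; this file takes it as
a HYPOTHESIS with the plan's `UnitReach` statement VERBATIM, so that the final assembly is the one-liner
`SF.joinHalf := SF.joinHalf_of_unitReach <J1 theorem>` (or the closer applies `joinHalf_of_unitReach` directly):

* `joinHalf_of_unitReach : UnitReach-statement → SF.JoinHalf` — (J1) + `SF.polarReach` give every Nakajima monomial
  `SF.monBasis … ρ ∈ W`, and the monomials are a basis of `H*(S^[n])` (`Module.Basis.span_eq`), so `W = ⊤`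
  (the plan's kernel-checked `joinHalf_of_plan`).

HONEST FRAMING: CONDITIONAL on (J1); nothing here asserts S-F ∕ L1-Hilb(5) ∕ L1 ∕ HC_Kum4Type ∕ HC.
-/

noncomputable section

open scoped TensorProduct DirectSum
open Literature.AlgebraicTopology.SingularHomology
open Literature.AlgebraicGeometry Literature.AlgebraicGeometry.Hyperkaehler Literature.AlgebraicGeometry.HilbertScheme
open Literature.AlgebraicGeometry.Motives (ComplexPoints SchemeOver IsSmoothProjective)

namespace Summit.Ventures.HodgeKum4.L1Hilb.SF

open Summit.Ventures.HodgeKum4.L1Hilb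

/-- **`SF.JoinHalf` from (J1)** (plan g19 `joinHalf_of_plan`, with (J2) discharged by the tree theorem `SF.polarReach`): if the
all-unit Nakajima monomials of every shape lie in every shape-graded `W ∋ 1_{S^[n]}` stable under cup with `G₁(1_S, n)` — the
plan's `UnitReach`, taken here as the hypothesis `hJ1` VERBATIM — then `SF.JoinHalf` holds: (J1) and the polarisations reach
every Nakajima monomial (`SF.polarReach`), and these form a basis of `H*(S^[n](ℂ); ℂ)` (`SF.monBasis`), so `W = ⊤`. -/
theorem joinHalf_of_unitReach
    (hJ1 : ∀ ⦃S : SchemeOver ℂ⦄ ⦃hS : IsSmoothProjective 2 S⦄ ⦃H : HilbertSchemesOfPoints S⦄ (𝔊 : ChernCharacterOperators hS H)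
      {ι : Type} [Fintype ι] [DecidableEq ι] (b : Module.Basis ι ℂ (totalCohomology ℂ (ComplexPoints S))) (i₀ : ι),
        b i₀ = unitCoeff S →
      ∀ (deg : ι → ℕ) (hb : ∀ i, b i ∈ LinearMap.range (ofDegree ℂ (ComplexPoints S) (deg i)))
        (n : ℕ) (W : Submodule ℂ (totalCohomology ℂ (ComplexPoints (H.obj n)))),
        ofDegree ℂ (ComplexPoints (H.obj n)) 0 (singularCohomology.one ℂ (ComplexPoints (H.obj n))) ∈ W →
        (∀ w ∈ W, totalCup ℂ (ComplexPoints (H.obj n)) (𝔊.G 1 n (unitCoeff S)) w ∈ W) →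
        ShapeGraded (monBasis 𝔊.toNakajimaOperators b deg hb n) (fun ρ ↦ shapeOf ρ.1) W →
        ∀ ρ : {ρ : Fin (Fintype.card ι) → Fin (n + 1) → ℕ // IsPartitionValued (deg ∘ (Fintype.equivFin ι).symm) n ρ},
          (∀ c, c ≠ Fintype.equivFin ι i₀ → ∀ r, ρ.1 c r = 0) →
          monBasis 𝔊.toNakajimaOperators b deg hb n ρ ∈ W) :
    JoinHalf := by
  intro S hS H 𝔊 C hCg hC ι _ _ b i₀ hb0 deg hb n W h1 h𝔡 hSG hP
  have hall : ∀ ρ, monBasis 𝔊.toNakajimaOperators b deg hb n ρ ∈ W :=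
    polarReach 𝔊.toNakajimaOperators C hCg hC b i₀ hb0 deg hb n W
      (fun ρ hρ ↦ hJ1 𝔊 b i₀ hb0 deg hb n W h1 h𝔡 hSG ρ hρ) hP
  refine eq_top_iff.mpr ?_
  rw [← (monBasis 𝔊.toNakajimaOperators b deg hb n).span_eq]
  exact Submodule.span_le.mpr (Set.range_subset_iff.mpr hall)

end Summit.Ventures.HodgeKum4.L1Hilb.SF

end
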